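import Literature.NumberTheory.EllipticCurves.Shintani32ConeGaussSums
import HarnessLib

/-!
# The Poisson step for the level-`32` kernel `K₃₂,D` and its evaluation at `c = 128`

[[cite: Shintani1975, §1 Prop. 1.6, §2 (2.1)]] — the `N = 32` twin of the tree's
`ShintaniKernelPoisson` (`N = 64`), for the kernel `K₃₂,D = 𝒦₃₂[c_D, 1/(128D)]` of
`Shintani32Kernel` (lattice `L♮₃₂ = {[32a, b, c]}`, weight `ω_D = genusWt32 D` supported on
`L₃₂ = {64 ∣ k₁}`; the kernel lifting the level-`32` newform into Tunnell's space, route to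
Waldspurger's corollary at level `128` and `Literature.NumberTheory.EllipticCurves.Tunnell1983_a_sq_propto_L_one`):

* **the Poisson step** `kerD32_smul`: for `γ = (a b; c d) ∈ SL₂(ℤ)`, `c > 0`, `8 ∣ c`, `N = cD`,
  `K₃₂,D(w, γz) = (Im γz)^{1/2} (2048N³)⁻¹ κ(Z') (64N)⁻¹ ∑_k 𝔊_γ(k) f_{w, z/(128D)}(ι♮₃₂ k)` with the
  Gauss coefficients `𝔊_γ(k) = e(d·disc ι♮₃₂k/(128N)) ∑_{r mod N} ω_D(r) ψ_N(a n₃₂(r) + ℓ(r,k))`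
  (split `v = Nq + r`, Poisson over `diag(32N,64N,N)ℤ³ + ι₃₂(r)` via the tree's
  `tsum_shintaniFn_diag`, the point identity `γz/(128D) = a/(128Dc) − 1/(128N(cz+d))`,
  `(64N) · S⁻¹(B m) = ι♮₃₂(swapNeg m)`, homogeneity `f_{w,z/(128D)}((64N)y) = 64N f_{w,32Nc z}(y)`);
* **the evaluation at `c = 128`** (`kerD32_smul_sigma`): by `Shintani32ConeGaussSums` the Gauss
  coefficient vanishes off `L₃₂` and equals `𝒦₃₂(a,a*) ω_D(v)` on it (`gaussCoef32_embed32`,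
  `𝒦₃₂(a,a*) = χ₈(-a*)χ₄(-a*)^{[D≡1(4)]} (-a*/D) · N · G(32a; N)`), so the kernel reproduces itself
  up to the constant `(2048N³)⁻¹ κ(Z') (64N)⁻¹ 𝒦₃₂(a, a*) (Im z)^{-1/2}`.

Everything is proved; definitions `auxW32`, `muN32`, `dualVec32`, `ptD32`, `gaussCoef32`, `evalConst32`.
-/

noncomputable section

open Complex Real
open scoped MatrixGroups

namespace Literature.NumberTheory.EllipticCurves.Shintani

open UpperHalfPlane hiding I

section Pieces

open Literature.NumberTheory.EllipticCurves.ModularForms (coe_smul_eq' det_eq_one'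
  moebius_eq_sub_inv' im_denom_pos)

/-- The auxiliary point `W = 32N(cz + d)` (`N = cD`). [folklore] -/
def auxW32 (N c : ℕ) [NeZero N] [NeZero c] (d : ℤ) (z : ℍ) : ℍ :=
  ((32 * N * d : ℤ) : ℝ) +ᵥ mulPos (32 * N * c) (by
    have := Nat.pos_of_ne_zero (NeZero.ne N); have := Nat.pos_of_ne_zero (NeZero.ne c)
    positivity) z

/-- `coe_auxW32` (auxiliary). [folklore] -/
theorem coe_auxW32 (N c : ℕ) [NeZero N] [NeZero c] (d : ℤ) (z : ℍ) :
    ((auxW32 N c d z : ℍ) : ℂ) = 32 * N * ((c : ℂ) * z + d) := by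
  rw [auxW32, UpperHalfPlane.coe_vadd, coe_mulPos]
  push_cast
  ring

/-- `coe_invFour_auxW32` (auxiliary). [folklore] -/
theorem coe_invFour_auxW32 (N c : ℕ) [NeZero N] [NeZero c] (d : ℤ) (z : ℍ) :
    ((invFour (auxW32 N c d z) : ℍ) : ℂ) = -1 / (128 * N * ((c : ℂ) * z + d)) := by
  rw [coe_invFour, coe_auxW32]
  ring

/-- **The point identity** `(γz)/(128D) = a/(128Dc) + (-1/(128 N (cz+d)))`, `N = cD`. [folklore] -/
theorem mulPos_smul_eq_vadd32 (D : ℕ) [NeZero D] (γ : SL(2, ℤ)) (c : ℕ) [NeZero c]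
    (hc : (γ 1 0 : ℤ) = c) (z : ℍ) :
    mulPos (1 / (128 * D)) (scale32_pos D) (γ • z) =
      ((γ 0 0 : ℤ) / (128 * D * c) : ℝ) +ᵥ invFour (auxW32 (c * D) c (γ 1 1) z) := by
  apply UpperHalfPlane.ext
  rw [coe_mulPos, UpperHalfPlane.coe_vadd, coe_invFour_auxW32, coe_smul_eq' γ z, hc, Int.cast_natCast]
  have hdet : ((γ 0 0 : ℤ) : ℂ) * (γ 1 1 : ℤ) - (γ 0 1 : ℤ) * (c : ℂ) = 1 := by
    have := det_eq_one' γ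
    rw [hc] at this
    exact_mod_cast this
  have hcz : (c : ℂ) * z + (γ 1 1 : ℤ) ≠ 0 := by
    have := im_denom_pos (c := c) (γ 1 1) z
    intro h; rw [h] at this; simp at this
  have hc0 : (c : ℂ) ≠ 0 := by exact_mod_cast NeZero.ne c
  have hD0 : (D : ℂ) ≠ 0 := by exact_mod_cast NeZero.ne D
  rw [moebius_eq_sub_inv' hc0 hdet hcz]
  push_cast
  field_simp
  ring

/-! #### Splitting `ℤ³` modulo `N` on `L₃₂` -/

/-- The scaling vector `μ = (32N, 64N, N)`. [folklore] -/
def muN32 (N : ℕ) : Fin 3 → ℝ := ![32 * N, 64 * N, N]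

/-- `one_le_muN32` (auxiliary). [folklore] -/
theorem one_le_muN32 (N : ℕ) [NeZero N] (i : Fin 3) : 1 ≤ muN32 N i := by
  have : (1 : ℝ) ≤ N := by exact_mod_cast Nat.pos_of_ne_zero (NeZero.ne N)
  fin_cases i
  · show (1 : ℝ) ≤ 32 * N; linarith
  · show (1 : ℝ) ≤ 64 * N; linarith
  · show (1 : ℝ) ≤ N; exact this

/-- `muN32_prod` (auxiliary). [folklore] -/
theorem muN32_prod (N : ℕ) : muN32 N 0 * muN32 N 1 * muN32 N 2 = 2048 * (N : ℝ) ^ 3 := by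
  simp [muN32]; ring

/-- `ι₃₂(Nq + r̃) = A q + ι₃₂(r̃)`, `A = diag(32N, 64N, N)`. [folklore] -/
theorem latFun32_splitEquiv (N : ℕ) [NeZero N] (q : Fin 3 → ℤ) (r : Fin 3 → ZMod N) :
    latFun32 (splitEquiv N (q, r)) =
      dgLin (muN32 N) (WithLp.toLp 2 fun i ↦ (q i : ℝ)) + latFun32 (liftZ r) := by
  ext i
  fin_cases i <;> simp [latFun32, dgLin_apply, muN32, splitEquiv_apply, liftZ] <;> ring

/-- `ω_D(Nq + r̃) = ω_D(r̃)` (`8 ∣ N`, `D ∣ N`). [folklore] -/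
theorem genusWt32_splitEquiv {D N : ℕ} [NeZero N] (h8 : 8 ∣ N) (hD : D ∣ N) (q : Fin 3 → ℤ)
    (r : Fin 3 → ZMod N) : genusWt32 D (splitEquiv N (q, r)) = genusWt32 D (liftZ r) := by
  refine genusWt32_congr (M := N) (by exact_mod_cast h8) (by exact_mod_cast hD) fun i ↦ ?_
  rw [splitEquiv_apply, liftZ]
  exact (Int.modEq_iff_dvd.mpr ⟨-q i, by ring⟩)

/-- `n₃₂(Nq + r̃) ≡ n₃₂(r̃) (mod N)`. [folklore] -/
theorem nQ32_splitEquiv (N : ℕ) [NeZero N] (q : Fin 3 → ℤ) (r : Fin 3 → ZMod N) :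
    ∃ m : ℤ, nQ32 (splitEquiv N (q, r)) = nQ32 (liftZ r) + N * m := by
  have h : nQ32 (splitEquiv N (q, r)) ≡ nQ32 (liftZ r) [ZMOD N] := by
    refine nQ32_emod_congr fun i ↦ ?_
    rw [splitEquiv_apply, liftZ]
    exact (Int.modEq_iff_dvd.mpr ⟨-q i, by ring⟩)
  obtain ⟨m, hm⟩ := Int.modEq_iff_dvd.mp h.symm
  exact ⟨m, by linear_combination hm⟩

/-! #### The dual side for `diag(32N, 64N, N)` -/

/-- The dual lattice vector `B m = (m₀/(32N), m₁/(64N), m₂/N)`. [folklore] -/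
def dualVec32 (N : ℕ) (m : Fin 3 → ℤ) : V :=
  dgLin (fun i ↦ (muN32 N i)⁻¹) (WithLp.toLp 2 fun i ↦ (m i : ℝ))

/-- `dualVec32_apply` (auxiliary). [folklore] -/
theorem dualVec32_apply (N : ℕ) (m : Fin 3 → ℤ) (i : Fin 3) : dualVec32 N m i = (muN32 N i)⁻¹ * m i := by
  rw [dualVec32, dgLin_apply]

/-- `(64N) · S⁻¹(B m) = ι♮₃₂(swapNeg m)`. [folklore] -/
theorem smul_sinv_dualVec32 (N : ℕ) [NeZero N] (m : Fin 3 → ℤ) :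
    ((64 * N : ℝ)) • sinv (dualVec32 N m) = latSharp32 (swapNeg m) := by
  have hN : (N : ℝ) ≠ 0 := by exact_mod_cast NeZero.ne N
  ext i
  fin_cases i <;> simp [sinv, dualVec32_apply, muN32, latSharp32] <;> field_simp <;> ring

/-- `disc(S⁻¹(B m)) = disc(ι♮₃₂(swapNeg m))/(64N)²`. [folklore] -/
theorem disc_sinv_dualVec32 (N : ℕ) [NeZero N] (m : Fin 3 → ℤ) :
    disc (sinv (dualVec32 N m)) = disc (latSharp32 (swapNeg m)) / (64 * N) ^ 2 := by
  have hN : (0 : ℝ) < 64 * N := by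
    have : (0 : ℝ) < N := by exact_mod_cast Nat.pos_of_ne_zero (NeZero.ne N)
    positivity
  rw [← smul_sinv_dualVec32 N m, disc_smul, eq_div_iff (by positivity)]
  ring

/-- `⟪ι₃₂(r̃), B m⟫ = (r̃₀m₀ + r̃₁m₁ + r̃₂m₂)/N`. [folklore] -/
theorem inner_latFun32_dualVec32 (N : ℕ) [NeZero N] (v m : Fin 3 → ℤ) :
    @inner ℝ V _ (latFun32 v) (dualVec32 N m) = ((v 0 * m 0 + v 1 * m 1 + v 2 * m 2 : ℤ) : ℝ) / N := by
  have hN : (N : ℝ) ≠ 0 := by exact_mod_cast NeZero.ne N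
  rw [inner_eq_sum_three]
  simp only [latFun32_zero, latFun32_one, latFun32_two, dualVec32_apply, muN32]
  simp
  field_simp

/-! #### Homogeneity at the kernel's scale -/

variable (D : ℕ) [NeZero D]

/-- The `D`-th scale as a point map `z ↦ z/(128D)`. [folklore] -/
abbrev ptD32 (z : ℍ) : ℍ := mulPos (1 / (128 * D)) (scale32_pos D) z

/-- `(64N)² / (128 D) = 32 N c` (`N = cD`), so `f_{w, z/(128D)}((64N) • y) = 64N · f_{w, 32Nc·z}(y)`.
[folklore] -/
theorem shintaniFn_ptD32_smul (c : ℕ) [NeZero c] (w z : ℍ) (y : V) :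
    shintaniFn w (ptD32 D z) (((64 * (c * D : ℕ) : ℝ)) • y) =
      (64 * (c * D : ℕ) : ℝ) * shintaniFn w (mulPos (32 * (c * D : ℕ) * c) (by
        have := Nat.pos_of_ne_zero (NeZero.ne c); have := Nat.pos_of_ne_zero (NeZero.ne D)
        positivity) z) y := by
  have hpos : (0 : ℝ) < 64 * (c * D : ℕ) := by
    have := Nat.pos_of_ne_zero (NeZero.ne c); have := Nat.pos_of_ne_zero (NeZero.ne D)
    positivity
  rw [shintaniFn_smul w (ptD32 D z) hpos y]
  congr 2
  rw [ptD32, mulPos_mulPos]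
  apply UpperHalfPlane.ext
  simp only [coe_mulPos]
  have hD : (D : ℂ) ≠ 0 := by exact_mod_cast NeZero.ne D
  push_cast
  field_simp
  ring

/-! #### The `q`-sum over a fixed residue class -/

/-- The value of `f_{w, W}` (`W = 32N(cz+d)`) at a dual vector, reduced to the kernel's own scale:
`f_{w,W}(S⁻¹Bm) = e(d·disc ι♮₃₂(k)/(128N)) · (64N)⁻¹ · f_{w, z/(128D)}(ι♮₃₂(k))`, `k = swapNeg m`. [folklore] -/
theorem shintaniFn_auxW32_sinv_dualVec32 (c : ℕ) [NeZero c] (d : ℤ) (w z : ℍ) (m : Fin 3 → ℤ) :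
    shintaniFn w (auxW32 (c * D) c d z) (sinv (dualVec32 (c * D) m)) =
      eR (d * disc (latSharp32 (swapNeg m)) / (128 * (c * D : ℕ))) *
        (((64 * (c * D : ℕ) : ℝ) : ℂ)⁻¹ * shintaniFn w (ptD32 D z) (latSharp32 (swapNeg m))) := by
  have hN : (0 : ℝ) < (c * D : ℕ) := by exact_mod_cast Nat.pos_of_ne_zero (NeZero.ne (c * D))
  set y : V := sinv (dualVec32 (c * D) m) with hy
  have h1 : shintaniFn w (auxW32 (c * D) c d z) y =
      cexp (2 * π * I * (((32 * (c * D : ℕ) * d : ℤ) : ℝ) * disc y)) *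
        shintaniFn w (mulPos (32 * (c * D : ℕ) * c) (by
          have := Nat.pos_of_ne_zero (NeZero.ne c); positivity) z) y := by
    unfold auxW32
    rw [shintaniFn_vadd]
  have h2 := shintaniFn_ptD32_smul D c w z y
  rw [hy, smul_sinv_dualVec32] at h2
  rw [← hy] at h2
  have h64 : ((64 * (c * D : ℕ) : ℝ) : ℂ) ≠ 0 := by
    have : (0 : ℝ) < 64 * (c * D : ℕ) := by positivity
    exact_mod_cast this.ne'
  have h3 : shintaniFn w (mulPos (32 * (c * D : ℕ) * c) (by
          have := Nat.pos_of_ne_zero (NeZero.ne c); positivity) z) y =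
      (((64 * (c * D : ℕ) : ℝ) : ℂ))⁻¹ * shintaniFn w (ptD32 D z) (latSharp32 (swapNeg m)) := by
    rw [eq_inv_mul_iff_mul_eq₀ h64, ← h2]
  rw [h1, h3]
  congr 1
  rw [eR, hy, disc_sinv_dualVec32]
  congr 1
  push_cast
  field_simp
  ring

open scoped FourierTransform RealInnerProductSpace in
/-- **The `q`-sum over the residue class `r`**:
`∑_q f_{w,Z'}(Aq + ι₃₂(r̃)) = (2048N³)⁻¹ κ(Z') (64N)⁻¹ ∑_k e(ℓ(r̃,k)/N) e(d·disc ι♮₃₂(k)/(128N)) f_{w,z/(128D)}(ι♮₃₂ k)`,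
`Z' = -1/(4W)`, `ℓ(r̃, k) = -r̃₀k₂ + r̃₁k₁ - r̃₂k₀`. [folklore] -/
theorem tsum_q_residue32 (c : ℕ) [NeZero c] (d : ℤ) (w z : ℍ) (r : Fin 3 → ZMod (c * D)) :
    ∑' q : Fin 3 → ℤ, shintaniFn w (invFour (auxW32 (c * D) c d z))
        (dgLin (muN32 (c * D)) (WithLp.toLp 2 fun i ↦ (q i : ℝ)) + latFun32 (liftZ r)) =
      (((2048 * ((c * D : ℕ) : ℝ) ^ 3)⁻¹ : ℝ) : ℂ) * kappa (invFour (auxW32 (c * D) c d z)) *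
        (((64 * (c * D : ℕ) : ℝ) : ℂ))⁻¹ *
        ∑' k : Fin 3 → ℤ,
          eR (((-(liftZ r 0) * k 2 + liftZ r 1 * k 1 - liftZ r 2 * k 0 : ℤ) : ℝ) / (c * D : ℕ)) *
          eR (d * disc (latSharp32 k) / (128 * (c * D : ℕ))) *
          shintaniFn w (ptD32 D z) (latSharp32 k) := by
  rw [tsum_shintaniFn_diag (one_le_muN32 (c * D)) (latFun32 (liftZ r)) w (invFour (auxW32 (c * D) c d z)),
    invFour_invFour, muN32_prod, Complex.real_smul]
  have hterm : ∀ m : Fin 3 → ℤ,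
      𝐞 (⟪latFun32 (liftZ r), dgLin (fun i ↦ (muN32 (c * D) i)⁻¹) (WithLp.toLp 2 fun i ↦ (m i : ℝ))⟫) •
        (kappa (invFour (auxW32 (c * D) c d z)) * shintaniFn w (auxW32 (c * D) c d z)
          (sinv (dgLin (fun i ↦ (muN32 (c * D) i)⁻¹) (WithLp.toLp 2 fun i ↦ (m i : ℝ))))) =
      kappa (invFour (auxW32 (c * D) c d z)) * ((((64 * (c * D : ℕ) : ℝ) : ℂ))⁻¹ *
        (eR (((liftZ r 0 * m 0 + liftZ r 1 * m 1 + liftZ r 2 * m 2 : ℤ) : ℝ) / (c * D : ℕ)) *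
          eR (d * disc (latSharp32 (swapNeg m)) / (128 * (c * D : ℕ))) *
          shintaniFn w (ptD32 D z) (latSharp32 (swapNeg m)))) := by
    intro m
    rw [fourierChar_smul_eq, show dgLin (fun i ↦ (muN32 (c * D) i)⁻¹) (WithLp.toLp 2 fun i ↦ (m i : ℝ)) =
      dualVec32 (c * D) m from rfl, inner_latFun32_dualVec32, shintaniFn_auxW32_sinv_dualVec32]
    ring
  simp_rw [hterm]
  rw [tsum_mul_left, tsum_mul_left, ← mul_assoc, ← mul_assoc]
  congr 1
  rw [← swapNegEquiv.tsum_eq]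
  refine tsum_congr fun k ↦ ?_
  show eR (((liftZ r 0 * (swapNeg k) 0 + liftZ r 1 * (swapNeg k) 1 + liftZ r 2 * (swapNeg k) 2 : ℤ) : ℝ) /
      (c * D : ℕ)) * eR (d * disc (latSharp32 (swapNeg (swapNeg k))) / (128 * (c * D : ℕ))) *
      shintaniFn w (ptD32 D z) (latSharp32 (swapNeg (swapNeg k))) = _
  rw [swapNeg_swapNeg, swapNeg_zero, swapNeg_one, swapNeg_two]
  congr 3
  push_cast
  ring

/-! ### The Gauss coefficients and the Poisson step -/

/-- **The Gauss coefficient** of the transformed kernel (`8 ∣ N = cD`):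
`𝔊_γ(k) = e(d · disc ι♮₃₂(k)/(128N)) · ∑_{r ∈ (ℤ/N)³} ω_D(r) ψ_N(a n₃₂(r) + ℓ(r, k))`. [folklore] -/
def gaussCoef32 (a d : ℤ) (c : ℕ) [NeZero c] (h8 : 8 ∣ c * D) (k : Fin 3 → ℤ) : ℂ :=
  eR (d * disc (latSharp32 k) / (128 * (c * D : ℕ))) *
    ∑ r : Fin 3 → ZMod (c * D), wN32 D h8 r * ZMod.stdAddChar ((a : ZMod (c * D)) * nZ32 r + ellZ r k)

omit [NeZero D] in
/-- `|ω_D(r)| ≤ 1` on residues. [folklore] -/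
theorem norm_wN32_le {M : ℕ} [NeZero M] (h8 : 8 ∣ M) (r : Fin 3 → ZMod M) : ‖wN32 D h8 r‖ ≤ 1 := by
  unfold wN32 wD32 twoWtR
  rw [norm_mul]
  have h1 : ‖((twoWt D ((ZMod.castHom h8 (ZMod 8) (r 2)).val : ℤ) : ℤ) : ℂ)‖ ≤ 1 := by
    rw [← Complex.ofReal_intCast, Complex.norm_real, Real.norm_eq_abs]
    exact_mod_cast abs_twoWt_le D _
  have h2 : ‖((∏ p ∈ D.primeFactors, coneSymZ32 p fun i ↦ ((r i).cast : ZMod p) : ℤ) : ℂ)‖ ≤ 1 := by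
    rw [← Complex.ofReal_intCast, Complex.norm_real, Real.norm_eq_abs, Int.cast_prod, Finset.abs_prod]
    refine Finset.prod_le_one (fun _ _ ↦ abs_nonneg _) fun p _ ↦ ?_
    unfold coneSymZ32
    exact_mod_cast abs_coneSym32_le p _
  calc _ ≤ 1 * 1 := mul_le_mul h1 h2 (norm_nonneg _) zero_le_one
    _ = 1 := one_mul 1

/-- The Gauss coefficients are bounded. [folklore] -/
theorem bddWeight_gaussCoef32 (a d : ℤ) (c : ℕ) [NeZero c] (h8 : 8 ∣ c * D) :
    BddWeight (gaussCoef32 D a d c h8) := by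
  refine ⟨(Fintype.card (Fin 3 → ZMod (c * D)) : ℝ), fun k ↦ ?_⟩
  unfold gaussCoef32
  rw [norm_mul, norm_eR, one_mul]
  refine (norm_sum_le _ _).trans ?_
  have : ∀ r : Fin 3 → ZMod (c * D),
      ‖wN32 D h8 r * ZMod.stdAddChar ((a : ZMod (c * D)) * nZ32 r + ellZ r k)‖ ≤ 1 := fun r ↦ by
    rw [norm_mul, AddChar.norm_apply, mul_one]
    exact norm_wN32_le D h8 r
  calc ∑ r : Fin 3 → ZMod (c * D), ‖wN32 D h8 r * ZMod.stdAddChar ((a : ZMod (c * D)) * nZ32 r + ellZ r k)‖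
      ≤ ∑ _r : Fin 3 → ZMod (c * D), (1 : ℝ) := Finset.sum_le_sum fun r _ ↦ this r
    _ = _ := by simp

open Literature.NumberTheory.LFunctions.Fourier (summable_one_add_norm_rpow_neg) in
omit [NeZero D] in
/-- Summability of the `L₃₂`-families `v ↦ ω_D(v) u(v) f_{w,Z}(ι₃₂ v)` for bounded `u`. [folklore] -/
theorem summable_L32_family (u : (Fin 3 → ℤ) → ℂ) (hu : ∀ v, ‖u v‖ ≤ 1) (w Z : ℍ) :
    Summable fun v : Fin 3 → ℤ ↦ (genusWt32 D v : ℂ) * u v * shintaniFn w Z (latFun32 v) := by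
  obtain ⟨C', hC'⟩ := norm_term_le32 (bddWeight_cD32 D) w Z
  refine Summable.of_norm_bounded ((summable_one_add_norm_rpow_neg (ι := Fin 3) (b := 4)
    (by norm_num)).mul_left C') fun v ↦ ?_
  have h := hC' (embed32 v)
  rw [cD32_embed32, latSharp32_embed32] at h
  have hC0 : 0 ≤ C' := by
    have h0 := hC' 0
    have e0 : (fun i : Fin 3 ↦ (((0 : Fin 3 → ℤ) i : ℤ) : ℝ)) = 0 := by funext i; simp
    rw [e0, norm_zero, add_zero, Real.one_rpow, mul_one] at h0
    exact le_trans (norm_nonneg _) h0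
  calc ‖(genusWt32 D v : ℂ) * u v * shintaniFn w Z (latFun32 v)‖
      = ‖u v‖ * ‖(genusWt32 D v : ℂ) * shintaniFn w Z (latFun32 v)‖ := by
        rw [norm_mul, norm_mul, norm_mul]; ring
    _ ≤ 1 * (C' * (1 + ‖fun i ↦ ((embed32 v i : ℤ) : ℝ)‖) ^ (-(4 : ℝ))) :=
        mul_le_mul (hu v) h (norm_nonneg _) zero_le_one
    _ ≤ 1 * (C' * (1 + ‖fun i ↦ ((v i : ℤ) : ℝ)‖) ^ (-(4 : ℝ))) := by
        refine mul_le_mul_of_nonneg_left (mul_le_mul_of_nonneg_left ?_ hC0) zero_le_one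
        · apply Real.rpow_le_rpow_of_nonpos (by positivity) ?_ (by norm_num)
          gcongr
          refine (pi_norm_le_iff_of_nonneg (norm_nonneg _)).mpr fun i ↦ ?_
          refine le_trans ?_ (norm_le_pi_norm (fun i ↦ ((embed32 v i : ℤ) : ℝ)) i)
          rw [Real.norm_eq_abs, Real.norm_eq_abs]
          fin_cases i <;> simp [embed32, abs_mul]
          nlinarith [abs_nonneg ((v 1 : ℤ) : ℝ)]
    _ = _ := one_mul _

/-- **The Poisson step for `K₃₂,D`.** For `γ = (a b; c d) ∈ SL₂(ℤ)` with `c > 0`, `8 ∣ c`, `N = cD`: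
`K₃₂,D(w, γz) = (Im γz)^{1/2} (2048N³)⁻¹ κ(Z') (64N)⁻¹ ∑_{k ∈ ℤ³} 𝔊_γ(k) f_{w, z/(128D)}(ι♮₃₂(k))`,
`Z' = -1/(128N(cz+d))`. [cite: Shintani1975, Prop. 1.6] -/
theorem kerD32_smul (γ : SL(2, ℤ)) (c : ℕ) [NeZero c] (hc : (γ 1 0 : ℤ) = c) (h8 : 8 ∣ c)
    (w z : ℍ) :
    kerD32 D w (γ • z) = (Real.sqrt (γ • z).im : ℂ) *
      ((((2048 * ((c * D : ℕ) : ℝ) ^ 3)⁻¹ : ℝ) : ℂ) * kappa (invFour (auxW32 (c * D) c (γ 1 1) z)) *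
        (((64 * (c * D : ℕ) : ℝ) : ℂ))⁻¹) *
      ∑' k : Fin 3 → ℤ, gaussCoef32 D (γ 0 0) (γ 1 1) c (dvd_mul_of_dvd_left h8 D) k *
        shintaniFn w (ptD32 D z) (latSharp32 k) := by
  set N : ℕ := c * D with hN
  set a : ℤ := γ 0 0 with ha
  set d : ℤ := γ 1 1 with hd
  have h8N : 8 ∣ c * D := dvd_mul_of_dvd_left h8 D
  have hDN : D ∣ c * D := dvd_mul_left D c
  have hNpos : (0 : ℝ) < (c * D : ℕ) := by exact_mod_cast Nat.pos_of_ne_zero (NeZero.ne (c * D))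
  set Z' : ℍ := invFour (auxW32 (c * D) c d z) with hZ'
  rw [kerD32_eq_tsum, mul_assoc]
  congr 1
  -- Step A: the point identity and the phase `e(a n(v)/N)`
  have hP : ptD32 D (γ • z) = ((a / (128 * D * c) : ℝ)) +ᵥ Z' := mulPos_smul_eq_vadd32 D γ c hc z
  have hA : ∀ v : Fin 3 → ℤ, (genusWt32 D v : ℂ) * shintaniFn w (ptD32 D (γ • z)) (latFun32 v) =
      (genusWt32 D v : ℂ) * eR (a * nQ32 v / (c * D : ℕ)) * shintaniFn w Z' (latFun32 v) := by
    intro v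
    rw [hP, shintaniFn_vadd, disc_latFun32, eR]
    conv_rhs => rw [mul_assoc]
    congr 2
    congr 1
    have hc0 : (c : ℂ) ≠ 0 := by exact_mod_cast NeZero.ne c
    have hD0 : (D : ℂ) ≠ 0 := by exact_mod_cast NeZero.ne D
    push_cast
    field_simp
  simp_rw [hA]
  -- Step B: reindex `v = Nq + r̃`
  set F : (Fin 3 → ℤ) → ℂ := fun v ↦ (genusWt32 D v : ℂ) * eR (a * nQ32 v / (c * D : ℕ)) *
    shintaniFn w Z' (latFun32 v) with hF
  have hFs : Summable F := summable_L32_family D (fun v ↦ eR (a * nQ32 v / (c * D : ℕ)))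
    (fun v ↦ (norm_eR _).le) w Z'
  set e : (Fin 3 → ZMod N) × (Fin 3 → ℤ) ≃ (Fin 3 → ℤ) :=
    (Equiv.prodComm _ _).trans (splitEquiv N) with he
  have he_apply : ∀ r q, e (r, q) = splitEquiv N (q, r) := fun r q ↦ rfl
  have hFe : Summable (F ∘ e) := (e.summable_iff).mpr hFs
  rw [show ∑' v, F v = ∑' p : (Fin 3 → ZMod N) × (Fin 3 → ℤ), (F ∘ e) p from (e.tsum_eq F).symm,
    hFe.tsum_prod' (fun r ↦ hFe.prod_factor r), tsum_fintype]
  simp only [Function.comp_apply]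
  -- Step C: each residue class
  have hC : ∀ r : Fin 3 → ZMod N, ∑' q : Fin 3 → ℤ, F (e (r, q)) =
      (genusWt32 D (liftZ r) : ℂ) * eR (a * nQ32 (liftZ r) / (c * D : ℕ)) *
        ((((2048 * ((c * D : ℕ) : ℝ) ^ 3)⁻¹ : ℝ) : ℂ) * kappa Z' * (((64 * (c * D : ℕ) : ℝ) : ℂ))⁻¹ *
        ∑' k : Fin 3 → ℤ,
          eR (((-(liftZ r 0) * k 2 + liftZ r 1 * k 1 - liftZ r 2 * k 0 : ℤ) : ℝ) / (c * D : ℕ)) *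
          eR (d * disc (latSharp32 k) / (128 * (c * D : ℕ))) *
          shintaniFn w (ptD32 D z) (latSharp32 k)) := by
    intro r
    have h1 : ∀ q, F (e (r, q)) = (genusWt32 D (liftZ r) : ℂ) * eR (a * nQ32 (liftZ r) / (c * D : ℕ)) *
        shintaniFn w Z' (dgLin (muN32 N) (WithLp.toLp 2 fun i ↦ (q i : ℝ)) + latFun32 (liftZ r)) := by
      intro q
      rw [he_apply, hF]
      dsimp only
      rw [genusWt32_splitEquiv h8N hDN, latFun32_splitEquiv]
      obtain ⟨m, hm⟩ := nQ32_splitEquiv N q r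
      rw [hm]
      congr 2
      push_cast
      have hNR : (N : ℝ) = (c : ℝ) * D := by rw [hN]; push_cast; ring
      have hc0 : (c : ℝ) ≠ 0 := by exact_mod_cast NeZero.ne c
      have hD0 : (D : ℝ) ≠ 0 := by exact_mod_cast NeZero.ne D
      have : (a : ℝ) * ((nQ32 (liftZ r) : ℝ) + (N : ℝ) * m) / ((c : ℝ) * D) =
          (a : ℝ) * (nQ32 (liftZ r)) / ((c : ℝ) * D) + ((a * m : ℤ) : ℝ) := by
        rw [hNR]; push_cast; field_simp
      rw [this, eR_add_int]
    simp_rw [h1]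
    rw [tsum_mul_left, tsum_q_residue32 D c d w z r]
  simp_rw [hC]
  -- Step D
  have hk_summ : ∀ r : Fin 3 → ZMod N, Summable fun k : Fin 3 → ℤ ↦
      eR (((-(liftZ r 0) * k 2 + liftZ r 1 * k 1 - liftZ r 2 * k 0 : ℤ) : ℝ) / (c * D : ℕ)) *
      eR (d * disc (latSharp32 k) / (128 * (c * D : ℕ))) * shintaniFn w (ptD32 D z) (latSharp32 k) := by
    intro r
    have := summable_term32 (c := fun k ↦
      eR (((-(liftZ r 0) * k 2 + liftZ r 1 * k 1 - liftZ r 2 * k 0 : ℤ) : ℝ) / (c * D : ℕ)) *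
      eR (d * disc (latSharp32 k) / (128 * (c * D : ℕ)))) ⟨1, fun k ↦ by
        rw [norm_mul, norm_eR, norm_eR, one_mul]⟩ w (ptD32 D z)
    exact this
  have hrk : ∀ (r : Fin 3 → ZMod N) (k : Fin 3 → ℤ),
      (genusWt32 D (liftZ r) : ℂ) * eR (a * nQ32 (liftZ r) / (c * D : ℕ)) *
        eR (((-(liftZ r 0) * k 2 + liftZ r 1 * k 1 - liftZ r 2 * k 0 : ℤ) : ℝ) / (c * D : ℕ)) =
      wN32 D h8N r * ZMod.stdAddChar ((a : ZMod (c * D)) * nZ32 r + ellZ r k) := by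
    intro r k
    rw [mul_assoc, ← eR_add, genusWt32_eq_wN32 h8N hDN (liftZ r)]
    have hl : ∀ i, (((liftZ r i : ℤ)) : ZMod (c * D)) = r i := fun i ↦ by
      rw [liftZ, Int.cast_natCast, ZMod.natCast_zmod_val]
    congr 1
    · congr 1; funext i; exact hl i
    · rw [show (a : ℝ) * (nQ32 (liftZ r) : ℝ) / (c * D : ℕ) +
          ((-(liftZ r 0) * k 2 + liftZ r 1 * k 1 - liftZ r 2 * k 0 : ℤ) : ℝ) / (c * D : ℕ) =
          ((a * nQ32 (liftZ r) + (-(liftZ r 0) * k 2 + liftZ r 1 * k 1 - liftZ r 2 * k 0) : ℤ) : ℝ) /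
            (c * D : ℕ) by push_cast; ring, eR_div_eq_stdAddChar]
      congr 1
      unfold nQ32 nZ32 ellZ
      push_cast
      rw [hl 0, hl 1, hl 2]
      ring
  set C : ℂ := (((2048 * ((c * D : ℕ) : ℝ) ^ 3)⁻¹ : ℝ) : ℂ) * kappa Z' *
    (((64 * (c * D : ℕ) : ℝ) : ℂ))⁻¹ with hCdef
  set A : (Fin 3 → ZMod N) → (Fin 3 → ℤ) → ℂ := fun r k ↦
    eR (((-(liftZ r 0) * k 2 + liftZ r 1 * k 1 - liftZ r 2 * k 0 : ℤ) : ℝ) / (c * D : ℕ)) *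
      eR (d * disc (latSharp32 k) / (128 * (c * D : ℕ))) * shintaniFn w (ptD32 D z) (latSharp32 k) with hAdef
  set ω : (Fin 3 → ZMod N) → ℂ := fun r ↦ (genusWt32 D (liftZ r) : ℂ) * eR (a * nQ32 (liftZ r) / (c * D : ℕ))
    with hωdef
  show ∑ r : Fin 3 → ZMod N, ω r * (C * ∑' k, A r k) = C * ∑' k, gaussCoef32 D a d c h8N k *
    shintaniFn w (ptD32 D z) (latSharp32 k)
  calc ∑ r : Fin 3 → ZMod N, ω r * (C * ∑' k, A r k)
      = C * ∑ r : Fin 3 → ZMod N, ∑' k, ω r * A r k := by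
        rw [Finset.mul_sum]
        refine Finset.sum_congr rfl fun r _ ↦ ?_
        rw [tsum_mul_left]; ring
    _ = C * ∑' k, ∑ r : Fin 3 → ZMod N, ω r * A r k := by
        rw [Summable.tsum_finsetSum (fun r _ ↦ (hk_summ r).mul_left (ω r))]
    _ = C * ∑' k, gaussCoef32 D a d c h8N k * shintaniFn w (ptD32 D z) (latSharp32 k) := by
        congr 1
        refine tsum_congr fun k ↦ ?_
        rw [gaussCoef32, Finset.mul_sum, Finset.sum_mul]
        refine Finset.sum_congr rfl fun r _ ↦ ?_
        rw [hωdef, hAdef]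
        dsimp only
        rw [← hrk r k]
        ring

end Pieces

/-! ### Evaluation at `c = 128`: the kernel reproduces itself -/

section Eval128

variable (D : ℕ) [NeZero D]

omit [NeZero D] in
/-- `8 ∣ 128 D`. [folklore] -/
theorem eight_dvd_128_mul : 8 ∣ 128 * D := dvd_mul_of_dvd_left (by norm_num) D

/-- Off `L₃₂` the Gauss coefficient vanishes (`c = 128`). [folklore] -/
theorem gaussCoef32_of_not_dvd (a d : ℤ) {k : Fin 3 → ℤ} (hk : ¬ (64 : ℤ) ∣ k 1) :
    gaussCoef32 D a d 128 (eight_dvd_128_mul D) k = 0 := by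
  unfold gaussCoef32
  rw [show ((a : ℤ) : ZMod (128 * D)) = (a : ZMod (128 * D)) from rfl,
    sum_wN32_mul_stdAddChar_eq_zero (eight_dvd_128_mul D) (a : ZMod (128 * D)) k hk, mul_zero]

/-- `ℓ(r, embed₃₂ v) = B(r, v mod N)`. [folklore] -/
theorem ellZ_embed32 {M : ℕ} (r : Fin 3 → ZMod M) (v : Fin 3 → ℤ) :
    ellZ r (embed32 v) = bZ32 r (fun i ↦ (v i : ZMod M)) := by
  simp only [ellZ, bZ32, embed32_zero, embed32_one, embed32_two]
  push_cast
  ring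

/-- The scalar of the scaling law: `χ₈(t) χ₄(t)^{[D≡1(4)]}` as a complex number. [folklore] -/
def twoFac (t : ℤ) : ℂ := ((ZMod.χ₈ t * (if D % 4 = 1 then (ZMod.χ₄ t : ℤ) else 1) : ℤ) : ℂ)

/-- The constant of the `c = 128` evaluation:
`𝒦₃₂(a, a*) = χ₈(-a*)χ₄(-a*)^{[D≡1(4)]} J(-a* | D) · N · G(32a; N)`, `N = 128D`. [folklore] -/
def evalConst32 (a a' : ℤ) : ℂ :=
  twoFac D (-a') * jacobiSym (-a') D * (128 * D : ℕ) *
    Literature.NumberTheory.EllipticCurves.ModularForms.quadGaussSum (128 * D) (32 * (a : ZMod (128 * D))) 0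

/-- **On `L₃₂` the Gauss coefficient reproduces the weight** (`c = 128`, `D` odd square-free,
`aa* ≡ 1 (mod 128D)`, `d ≡ a* (mod 128)`): `𝔊_σ(embed₃₂ v) = 𝒦₃₂(a,a*) ω_D(v)`. [folklore] -/
theorem gaussCoef32_embed32 (hsq : Squarefree D) (hodd : Odd D) (a a' d : ℤ)
    (haa' : (a : ZMod (128 * D)) * (a' : ZMod (128 * D)) = 1) (hda : (128 : ℤ) ∣ d - a') (v : Fin 3 → ℤ) :
    gaussCoef32 D a d 128 (eight_dvd_128_mul D) (embed32 v) = evalConst32 D a a' * genusWt32 D v := by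
  have h8 := eight_dvd_128_mul D
  have hDN : D ∣ 128 * D := dvd_mul_left D 128
  unfold gaussCoef32
  simp_rw [ellZ_embed32]
  rw [sum_wN32_mul_stdAddChar_bZ32 hsq hodd h8 (a : ZMod (128 * D)) (a' : ZMod (128 * D)) haa'
    (fun i ↦ (v i : ZMod (128 * D)))]
  have hw : wN32 D h8 (-((a' : ZMod (128 * D)) • fun i ↦ (v i : ZMod (128 * D)))) =
      twoFac D (-a') * jacobiSym (-a') D * genusWt32 D v := by
    have e : (-((a' : ZMod (128 * D)) • fun i ↦ (v i : ZMod (128 * D)))) =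
        fun i ↦ ((((-a') • v) i : ℤ) : ZMod (128 * D)) := by
      funext i; simp [Pi.smul_apply, smul_eq_mul]
    rw [e, ← genusWt32_eq_wN32 h8 hDN, genusWt32_smul hsq, twoFac]
    push_cast
    ring
  rw [hw, latSharp32_embed32, disc_latFun32]
  by_cases hv : genusWt32 D v = 0
  · simp [hv]
  · have hDn : (D : ℤ) ∣ nQ32 v := by
      by_contra h; exact hv (genusWt32_of_not_dvd hsq h)
    have hphase : eR (d * (128 * (nQ32 v : ℝ)) / (128 * (128 * D : ℕ))) *
        (ZMod.stdAddChar (-((a' : ZMod (128 * D)) * nZ32 fun i ↦ (v i : ZMod (128 * D)))) : ℂ) = 1 := by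
      have e1 : (d : ℝ) * (128 * (nQ32 v : ℝ)) / (128 * (128 * D : ℕ)) = ((d * nQ32 v : ℤ) : ℝ) / (128 * D : ℕ) := by
        have : ((128 * D : ℕ) : ℝ) ≠ 0 := by exact_mod_cast NeZero.ne (128 * D)
        push_cast; field_simp
      have e2 : (nZ32 fun i ↦ (v i : ZMod (128 * D))) = ((nQ32 v : ℤ) : ZMod (128 * D)) := by
        unfold nZ32 nQ32; push_cast; ring
      rw [e1, eR_div_eq_stdAddChar, e2, ← AddChar.map_add_eq_mul]
      have : ((d * nQ32 v : ℤ) : ZMod (128 * D)) + -((a' : ZMod (128 * D)) * ((nQ32 v : ℤ) : ZMod (128 * D))) = 0 := by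
        obtain ⟨m, hm⟩ := hDn
        obtain ⟨e, he⟩ := hda
        have : (d * nQ32 v - a' * nQ32 v : ℤ) = (128 * D : ℕ) * (e * m) := by
          rw [← sub_mul, he, hm]; push_cast; ring
        have h0 : ((d * nQ32 v - a' * nQ32 v : ℤ) : ZMod (128 * D)) = 0 := by
          rw [this, Int.cast_mul, Int.cast_natCast, ZMod.natCast_self, zero_mul]
        push_cast at h0 ⊢
        linear_combination h0
      rw [this, AddChar.map_zero_eq_one]
    unfold evalConst32
    linear_combination (twoFac D (-a') * jacobiSym (-a') D * genusWt32 D v * (128 * D : ℕ) *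
      Literature.NumberTheory.EllipticCurves.ModularForms.quadGaussSum (128 * D)
        (32 * (a : ZMod (128 * D))) 0) * hphase

/-- A series of Gauss coefficients against `ι♮₃₂` collapses to the weight series against `ι₃₂`. [folklore] -/
theorem tsum_gaussCoef32_mul (hsq : Squarefree D) (hodd : Odd D) (a a' d : ℤ)
    (haa' : (a : ZMod (128 * D)) * (a' : ZMod (128 * D)) = 1) (hda : (128 : ℤ) ∣ d - a')
    (F : V → ℂ) :
    ∑' k : Fin 3 → ℤ, gaussCoef32 D a d 128 (eight_dvd_128_mul D) k * F (latSharp32 k) =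
      evalConst32 D a a' * ∑' v : Fin 3 → ℤ, (genusWt32 D v : ℂ) * F (latFun32 v) := by
  have hsupp : Function.support (fun k : Fin 3 → ℤ ↦ gaussCoef32 D a d 128 (eight_dvd_128_mul D) k *
      F (latSharp32 k)) ⊆ Set.range embed32 := by
    intro k hk
    rw [Function.mem_support] at hk
    by_cases h : (64 : ℤ) ∣ k 1
    · obtain ⟨k1, hk1⟩ := h
      exact ⟨![k 0, k1, k 2], by funext i; fin_cases i <;> simp [embed32, hk1]⟩
    · exact absurd (by rw [gaussCoef32_of_not_dvd D a d h, zero_mul]) hk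
  rw [← tsum_subtype_eq_of_support_subset hsupp,
    ← (Equiv.ofInjective embed32 embed32_injective).tsum_eq, ← tsum_mul_left]
  refine tsum_congr fun v ↦ ?_
  simp only [Equiv.ofInjective_apply]
  rw [gaussCoef32_embed32 D hsq hodd a a' d haa' hda, latSharp32_embed32]
  ring

/-- **The kernel reproduces itself under `σ = (a b; 128 d)`** (`D` odd square-free, `aa* ≡ 1 (mod 128D)`):
`K₃₂,D(w, σz) = (Im σz)^{1/2} (2048N³)⁻¹ κ(Z') (64N)⁻¹ 𝒦₃₂(a,a*) (Im z)^{-1/2} K₃₂,D(w, z)`. [folklore] -/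
theorem kerD32_smul_sigma (hsq : Squarefree D) (hodd : Odd D) (σ : SL(2, ℤ)) (hc : (σ 1 0 : ℤ) = 128)
    (a' : ℤ) (haa' : ((σ 0 0 : ℤ) : ZMod (128 * D)) * (a' : ZMod (128 * D)) = 1) (w z : ℍ) :
    kerD32 D w (σ • z) = (Real.sqrt (σ • z).im : ℂ) *
      ((((2048 * ((128 * D : ℕ) : ℝ) ^ 3)⁻¹ : ℝ) : ℂ) * kappa (invFour (auxW32 (128 * D) 128 (σ 1 1) z)) *
        (((64 * (128 * D : ℕ) : ℝ) : ℂ))⁻¹) *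
      (evalConst32 D (σ 0 0) a' * ((Real.sqrt z.im : ℂ))⁻¹ * kerD32 D w z) := by
  have hda : (128 : ℤ) ∣ (σ 1 1 : ℤ) - a' := by
    have hdet := Literature.NumberTheory.EllipticCurves.ModularForms.det_eq_one' σ
    rw [hc] at hdet
    have h1 : ((σ 0 0 : ℤ) : ZMod 128) * ((σ 1 1 : ℤ) : ZMod 128) = 1 := by
      have := congrArg (fun x : ℤ ↦ (x : ZMod 128)) hdet
      push_cast at this
      have h128 : (128 : ZMod 128) = 0 := by decide
      rw [h128, mul_zero, sub_zero] at this
      exact this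
    have h2 : ((σ 0 0 : ℤ) : ZMod 128) * ((a' : ℤ) : ZMod 128) = 1 := by
      have := congrArg (ZMod.castHom (dvd_mul_right 128 D) (ZMod 128)) haa'
      rw [map_mul, map_one, map_intCast, map_intCast] at this
      exact this
    have hu : IsUnit ((σ 0 0 : ℤ) : ZMod 128) := IsUnit.of_mul_eq_one _ h1
    have h3 : ((σ 1 1 : ℤ) : ZMod 128) = ((a' : ℤ) : ZMod 128) := by
      have := hu.mul_left_cancel (h1.trans h2.symm)
      exact this
    have h4 : (((σ 1 1 : ℤ) - a' : ℤ) : ZMod 128) = 0 := by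
      push_cast
      rw [h3, sub_self]
    exact_mod_cast (ZMod.intCast_zmod_eq_zero_iff_dvd _ 128).mp h4
  haveI : NeZero (128 : ℕ) := ⟨by norm_num⟩
  rw [kerD32_smul D σ 128 hc (by norm_num) w z]
  congr 1
  rw [tsum_gaussCoef32_mul D hsq hodd (σ 0 0) a' (σ 1 1) haa' hda _, kerD32_eq_tsum]
  have hz : (Real.sqrt z.im : ℂ) ≠ 0 := by
    exact_mod_cast (Real.sqrt_pos.mpr z.im_pos).ne'
  field_simp

end Eval128

end Literature.NumberTheory.EllipticCurves.Shintani
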